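import Summits.BirchSwinnertonDyer.BirchSwinnertonDyer.Theorems.ClassRecordThreeCornerTwinHalves
import Summits.BirchSwinnertonDyer.BirchSwinnertonDyer.Theorems.ClassRecordThreeCornerAtThreeBranchesDefs
import Literature.NumberTheory.GaloisCohomology.PoitouTateNumberField
import Summits.BirchSwinnertonDyer.Rank1Residual.GaloisImage.PropagatedConditionCardEP
import Summits.BirchSwinnertonDyer.BirchSwinnertonDyer.Theses.ClassRecordThree
import HarnessLib

/-!
# Crux `CornerAtThreeW` (item stmt-BirchSwinnertonDyer-21420) — the ONE-FRAME certificate: what the route CONSUMES of the corner is ONE odd Heegner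
# Manin-good datum carrying STEP L's index inequality, `BSD₃` of its twin, and (on `3 ∣ ∏c`) Kolyvagin's sharp bound — at THAT datum only
# (cell `bsd-stepL`, seat `bsd-stepL-corner3-p2` g16 = WIDTH-LEVER lane B; `--supports stmt-BirchSwinnertonDyer-21420 --as helper`)

HONEST FRAMING: THEOREMS ONLY (no definition, no named fact, no `sorry`); every theorem is CONDITIONAL on its displayed binders; nothing here is
a BSD class theorem; no census label moves (T7); item 21420 is NOT closed; no restate is proposed by this file (restates are director-gated).
EVIDENCE complementing lane B g16's STRENGTH certificate `…CornerAtThreeWStrength` (p664868 ∕ p665379): THERE the crux as typed was shown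
EQUIVALENT to the ∀-(Tw) crux 19111 modulo print (the ∀-over-frames of (L) and (U) pin `BSD₃` of every odd Heegner twist); HERE the LOWER
end of the scale — the route's consumer (`Theorems.CornerTwistWitness.multiplicativeRankOneAtThree_of_classRecord_upperB_of_twistWitness`, corner
branch: `BSDp W 3` for corner `W`) needs the three conjuncts at ONE frame only.

* §1 `bsdp_three_corner_of_oneFrameData` — datum level: for a corner curve and ONE odd Heegner Manin-good datum `(N(E), K, Dt, H, ι, P)` with a
  globally minimal twist model `Wd`: STEP L's output `IndexLowerBoundAt W 3 K P` at the datum ∧ `BSDp Wd 3` ∧ (on `3 ∣ ∏c`) the Tamagawa-sharp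
  Kolyvagin inequality at the datum ⟹ `BSDp W 3`, modulo print {GZ, Kolyvagin, GZK, modularity, Matar–Nekovář 2019 Thm. 0.3 on `3 ∤ ∏c`}. Assembly of
  multr1-p2 ∕ x11b3 bridges `missingLowerBoundAt_of_indexLowerBoundAt`, `missingUpperBoundAt_of_shaIndexBound_sharp`, `missingUpperBoundAt_of_shaIndexBound`,
  `bsdp_of_halves`.
* §2 `bsdp_three_corner_of_exists_oneFrame` — the same with the datum packaged as ONE ∃-hypothesis spelled INLINE (the candidate «one-frame» shape
  of the corner obligation; no new `def`).
* §4 `bsdp_three_corner_of_cornerAtThreeW_via_oneFrame` — the loop closed BY NAME on the route decl: crux ⟹ (§3) one-frame ∃ ⟹ (§2) `BSDp W 3`.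
* §3 `exists_oneFrame_of_cornerConjuncts` — the crux's three conjuncts (L) `CornerStepLAt W`, (W) `CornerTwistWitnessAt W`, (U) `CornerUpperAt W` supply
  that ∃ at the WITNESS frame (Manin-good datum there by `exists_maninDatum_of_odd`; STEP L through x11b3's image-free bridge with Poitou–Tate sum and
  local Euler–Poincaré discharged by tree theorems). So: crux ⟹ one-frame ∃ ⟹ `BSD₃(E)` on the corner, and the ∃ is ALL the consumer reads.

References: [JetchevSkinnerWan2017] §7.4.1–§7.4.2 (pp. 29–31); [MatarNekovar2019] Thm. 0.3; [Mazur1978] Cor. 4.1; [Miller2011LMS] Def. 1.1; tree: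
`X11b/BDPRouteHalves.lean`, `X11b/Three/JetchevShapeOverK.lean`, `X11b/Three/CornerResidual.lean`, `X11b/BDPRouteOddPrime.lean`. presearch: n∕a.
-/

set_option autoImplicit false
set_option linter.dupNamespace false

noncomputable section

open scoped Classical NumberField

open WeierstrassCurve NumberField IsDedekindDomain Literature.NumberTheory.EllipticCurves
  Literature.NumberTheory.EllipticCurves.ModularForms
  Literature.NumberTheory.EllipticCurves.Rank1Residual
  Literature.NumberTheory.EllipticCurves.Rank1Residual.Typed
  Literature.NumberTheory.QuadraticFields.Quadratic
  Literature.NumberTheory.GaloisCohomology Literature.NumberTheory.GaloisRepresentations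
  Summit.BirchSwinnertonDyer.Rank1Residual
  Summit.BirchSwinnertonDyer.Rank1Residual.X11b
  Summit.BirchSwinnertonDyer.Rank1Residual.X11b.Three
  Summit.BirchSwinnertonDyer.BirchSwinnertonDyer.Theorems

namespace Summit.BirchSwinnertonDyer.BirchSwinnertonDyer.Theorems.CornerStrength

/-! ### §1 Datum level -/

/-- **ONE odd Heegner Manin-good datum carrying the three corner inputs AT THAT DATUM gives `BSD(E,3)`.** Data: a corner-type pair (`(E,3) ∈` X11b),
`K` imaginary quadratic with `d_K` odd, Heegner for `N(E)`, `L(E^{(d_K)},1) ≠ 0`; a Manin-good datum `(Dt, H, ι, P)` of level `N(E)` (`3 ∤ c(Dt)`, `P` the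
Heegner point); a globally minimal model `Wd = Cd • E^{(d_K)}`. Inputs AT THE DATUM: (L′) `IndexLowerBoundAt W 3 K P` (`2v(I) ≤ v(Ш_K) + 2v(∏c)` — what
`CornerStepLAt` yields there through x11b3's bridge), (W′) `BSDp Wd 3`, (U′♯) on `3 ∣ ∏c`: `Ш(E/K)` finite → `P` non-torsion → `v(Ш_K) + 2v(∏c) ≤ 2v(I)`
(what `CornerUpperAt` says there). Then: `3 ∤ d_K`, `3 ∤ #𝓞_K^×` (`3 ∣ N` splits); `v(u(Cd)) = 0`, `v(∏c_d) = v(∏c)`; the twin's print shape from (W′)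
(`exists_LOne_div_realPeriodRat_of_bsdp_rankZero`); LOWER half of `E` by `missingLowerBoundAt_of_indexLowerBoundAt` on (L′) + the twin's `≤`-half; UPPER
half by `missingUpperBoundAt_of_shaIndexBound_sharp` on (U′♯) + the twin's `≥`-half when `3 ∣ ∏c`, else by `missingUpperBoundAt_of_shaIndexBound` on
Matar–Nekovář (`d_K ∉ {−3, −4}`); `bsdp_of_halves`. PUBLISHED binders `hGZ`, `hKo`, `hGZK`, `hmod`, `hMN`. CONDITIONAL; nothing booked.
[cite: JetchevSkinnerWan2017, §7.4.1–§7.4.2, pp. 29–31] [cite: MatarNekovar2019, Thm. 0.3 (p. 456)] [cite: Miller2011LMS, Def. 1.1] -/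
theorem bsdp_three_corner_of_oneFrameData [Fact (Nat.Prime 3)]
    (hGZ : ∀ (N : ℕ) [NeZero N] (W : WeierstrassCurve ℚ) (K : Type) [Field K] [NumberField K],
      gross_zagier N W K)
    (hKo : ∀ (N : ℕ) [NeZero N] (W : WeierstrassCurve ℚ) (K : Type) [Field K] [NumberField K],
      kolyvagin N W K)
    (hGZK : rank_eq_analyticRank_of_analyticRank_le_one) (hmod : hasEntireLFunction_rat)
    (hMN : ∀ (N : ℕ) [NeZero N] (W : WeierstrassCurve ℚ) (K : Type) [Field K] [NumberField K],
      MatarNekovar2019.thm03_padicValNat_card_sha_le_of_irreducible N W K)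
    (W : WeierstrassCurve ℚ) [W.IsElliptic] [W.IsGloballyMinimal] [NeZero (W.conductorNorm ℤ)] (hX : ClassX11b W 3)
    (K : Type) [Field K] [NumberField K]
    (Dt : ModularParametrizationData W (W.conductorNorm ℤ)) (H : HeegnerDatum (W.conductorNorm ℤ) (NumberField.discr K))
    (ι : K →+* ℂ) (P : (W.baseChange K).toAffine.Point)
    (hK : IsImaginaryQuadratic K) (hodd : Odd (NumberField.discr K))
    (hHN : SatisfiesHeegnerHypothesis (W.conductorNorm ℤ) K)
    (hLt : (W.quadraticTwist (NumberField.discr K : ℚ)).entireLFunction 1 ≠ 0)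
    (hP : WeierstrassCurve.Affine.Point.map ι.toRatAlgHom P = heegnerPointComplex Dt H) (hc : ¬ (3 : ℤ) ∣ Dt.c)
    (Wd : WeierstrassCurve ℚ) [Wd.IsElliptic] [Wd.IsGloballyMinimal] (Cd : VariableChange ℚ)
    (hWd : Cd • W.quadraticTwist (NumberField.discr K : ℚ) = Wd)
    (hIdx : IndexLowerBoundAt W 3 K P) (hbsd : BSDp Wd 3)
    (hUp : 3 ∣ W.tamagawaProduct → Finite (W.baseChange K).sha → ¬ IsOfFinAddOrder P →
      padicValNat 3 (W.baseChange K).shaOrder + 2 * padicValNat 3 W.tamagawaProduct ≤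
        2 * padicValNat 3 (AddSubgroup.zmultiples P).index) :
    BSDp W 3 := by
  obtain ⟨hr, hp2, hmult, hirr⟩ := id hX
  have hpN : 3 ∣ W.conductorNorm ℤ :=
    (W.dvd_conductorNorm_iff_not_hasGoodReductionAtPrime 3).mpr
      (WeierstrassCurve.HasMultiplicativeReduction.not_hasGoodReduction (R := ℤ_[3]) hmult)
  obtain ⟨hpd, hμ⟩ := Three.not_dvd_discr_and_not_dvd_torsionOrder_of_heegner (p := 3) hK hHN hp2 hpN
  have hD0 : (NumberField.discr K : ℚ) ≠ 0 := by exact_mod_cast NumberField.discr_ne_zero K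
  haveI hEt : (W.quadraticTwist (NumberField.discr K : ℚ)).IsElliptic := W.isElliptic_quadraticTwist hD0
  have hu : padicValRat 3 (Cd.u : ℚ) = 0 := padicValRat_u_eq_zero_of_twist_minimal W 3 K hK hHN hmult Cd hWd
  have htam : padicValNat 3 Wd.tamagawaProduct = padicValNat 3 W.tamagawaProduct :=
    X2.padicValNat_tamagawaProduct_twist_of_heegner_of_odd W 3 hp2 K hK hodd hpd hHN Cd hWd
  have hLt' : (W.quadraticTwist (NumberField.discr K : ℚ)).entireLFunction = Wd.entireLFunction := by
    rw [← hWd, entireLFunction_smul]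
  have hLd1 : Wd.entireLFunction 1 ≠ 0 := by rw [← hLt']; exact hLt
  have hrd : Wd.analyticRank = 0 := (Wd.analyticRank_eq_zero_iff_holds (hmod Wd)).2 hLd1
  -- the twin's exact print shape from (W′)
  obtain ⟨qd, hqd, hvqd⟩ := exists_LOne_div_realPeriodRat_of_bsdp_rankZero hGZK hmod Wd 3 hrd hbsd
  -- LOWER half of `E`: (L′) + the twin's `≤`-half
  have hl : Typed.MissingLowerBoundAt W 3 :=
    missingLowerBoundAt_of_indexLowerBoundAt W 3 (W.conductorNorm ℤ) K Dt H ι P (hGZ _ W K) (hKo _ W K) hGZK hmod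
      hK hHN hP hp2 hc hμ hr hLt Wd Cd hWd hu htam ⟨qd, hqd, hvqd.ge⟩ (fun _ ↦ hIdx)
  -- UPPER half of `E`: (U′♯) + the twin's `≥`-half on `3 ∣ ∏c`; Matar–Nekovář on `3 ∤ ∏c`
  have hu' : Typed.MissingUpperBoundAt W 3 := by
    by_cases ht : 3 ∣ W.tamagawaProduct
    · exact missingUpperBoundAt_of_shaIndexBound_sharp W 3 (W.conductorNorm ℤ) K Dt H ι P (hGZ _ W K) (hKo _ W K)
        hGZK hmod hK hHN hP hp2 hc hμ hr hLt Wd Cd hWd hu htam le_rfl ⟨qd, hqd, hvqd.le⟩ (hUp ht)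
    · have hD3 : NumberField.discr K ≠ -3 := fun h ↦ hpd ⟨-1, by rw [h]; norm_num⟩
      have hD4 : NumberField.discr K ≠ -4 := fun h ↦ by
        rw [h] at hodd; exact absurd hodd (by decide)
      exact missingUpperBoundAt_of_shaIndexBound W 3 (W.conductorNorm ℤ) K Dt H ι P (hGZ _ W K) (hKo _ W K)
        hGZK hmod hK hHN hP hp2 hc hμ hr hLt Wd Cd hWd hu htam ht ⟨qd, hqd, hvqd.le⟩
        (fun _ hnt ↦ hMN _ W K hK hHN hD3 hD4 ⟨Dt, H, ι, hP⟩ hnt Nat.prime_three (by decide) hirr)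
  exact bsdp_of_halves hGZK W 3 (by rw [hr]) hl hu'

/-! ### §2 The ∃-packaged one-frame shape (spelled inline; no new definition) -/

/-- **`BSD(E,3)` on the corner from ONE ∃-packaged frame.** The hypothesis `hOne` is the candidate «one-frame» shape of the corner obligation, INLINE:
SOME imaginary quadratic `K` (`d_K` odd, Heegner for `N(E)`, `L(E^{(d_K)},1) ≠ 0`), SOME Manin-good datum `(Dt, H, ι, P)` of level `N(E)` and SOME globally
minimal twist model `Wd = Cd • E^{(d_K)}` with (L′) ∧ (W′) ∧ (U′♯) at that datum. Bookkeeping over §1. CONDITIONAL; nothing booked; NOT a restate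
(director-gated) — a certified reading of what suffices. [cite: JetchevSkinnerWan2017, §7.4.1–§7.4.2] [cite: MatarNekovar2019, Thm. 0.3] [cite: Miller2011LMS, Def. 1.1] -/
theorem bsdp_three_corner_of_exists_oneFrame [Fact (Nat.Prime 3)]
    (hGZ : ∀ (N : ℕ) [NeZero N] (W : WeierstrassCurve ℚ) (K : Type) [Field K] [NumberField K],
      gross_zagier N W K)
    (hKo : ∀ (N : ℕ) [NeZero N] (W : WeierstrassCurve ℚ) (K : Type) [Field K] [NumberField K],
      kolyvagin N W K)
    (hGZK : rank_eq_analyticRank_of_analyticRank_le_one) (hmod : hasEntireLFunction_rat)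
    (hMN : ∀ (N : ℕ) [NeZero N] (W : WeierstrassCurve ℚ) (K : Type) [Field K] [NumberField K],
      MatarNekovar2019.thm03_padicValNat_card_sha_le_of_irreducible N W K)
    (W : WeierstrassCurve ℚ) [W.IsElliptic] [W.IsGloballyMinimal] [NeZero (W.conductorNorm ℤ)] (hX : ClassX11b W 3)
    (hOne : ∃ (K : Type) (_ : Field K) (_ : NumberField K)
      (Dt : ModularParametrizationData W (W.conductorNorm ℤ)) (H : HeegnerDatum (W.conductorNorm ℤ) (NumberField.discr K))
      (ι : K →+* ℂ) (P : (W.baseChange K).toAffine.Point)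
      (Wd : WeierstrassCurve ℚ) (_ : Wd.IsElliptic) (_ : Wd.IsGloballyMinimal) (Cd : VariableChange ℚ),
      IsImaginaryQuadratic K ∧ Odd (NumberField.discr K) ∧ SatisfiesHeegnerHypothesis (W.conductorNorm ℤ) K ∧
        (W.quadraticTwist (NumberField.discr K : ℚ)).entireLFunction 1 ≠ 0 ∧
        WeierstrassCurve.Affine.Point.map ι.toRatAlgHom P = heegnerPointComplex Dt H ∧ ¬ (3 : ℤ) ∣ Dt.c ∧
        Cd • W.quadraticTwist (NumberField.discr K : ℚ) = Wd ∧
        IndexLowerBoundAt W 3 K P ∧ BSDp Wd 3 ∧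
        (3 ∣ W.tamagawaProduct → Finite (W.baseChange K).sha → ¬ IsOfFinAddOrder P →
          padicValNat 3 (W.baseChange K).shaOrder + 2 * padicValNat 3 W.tamagawaProduct ≤
            2 * padicValNat 3 (AddSubgroup.zmultiples P).index)) :
    BSDp W 3 := by
  obtain ⟨K, _, _, Dt, H, ι, P, Wd, _, _, Cd, hK, hodd, hHN, hLt, hP, hc, hWd, hIdx, hbsd, hUp⟩ := hOne
  exact bsdp_three_corner_of_oneFrameData hGZ hKo hGZK hmod hMN W hX K Dt H ι P hK hodd hHN hLt hP hc Wd Cd hWd hIdx hbsd hUp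

/-! ### §3 The crux's conjuncts supply the one-frame ∃ at the witness -/

/-- **(L) ∧ (W) ∧ (U) ⟹ the one-frame ∃ of §2, at the WITNESS frame.** The witness (W) names `K`, `Wd`, `Cd` with `BSDp Wd 3`; a Manin-good datum THERE
exists by `exists_maninDatum_of_odd` (newforms `hnf`, Mazur 1978 Cor. 4.1 `hMaz`, Néron scaling a tree theorem); (L) at that datum gives
`IndexLowerBoundAt W 3 K P` by x11b3's `indexLowerBoundAt_of_cornerStepLAt` (Poitou–Tate sum and local Euler–Poincaré are the tree theorems
`poitouTate_sum_localTatePairing_eq_zero_holds`, `GaloisImage.EP.localEulerPoincareCharacteristic_adicCompletion`); (U) at that datum is (U′♯) verbatim.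
CONDITIONAL; nothing booked. With §2: crux ⟹ one-frame ∃ ⟹ `BSD₃(E)` on the corner — the ∃ is everything the route's consumer reads of 21420.
[cite: Mazur1978, Cor. 4.1] [cite: MilneADT2006, Ch. I, Thm. 4.10(b) and Thm. 2.8] [cite: JetchevSkinnerWan2017, §7.4.1] -/
theorem exists_oneFrame_of_cornerConjuncts [Fact (Nat.Prime 3)]
    (hGZ : ∀ (N : ℕ) [NeZero N] (W : WeierstrassCurve ℚ) (K : Type) [Field K] [NumberField K],
      gross_zagier N W K)
    (hKo : ∀ (N : ℕ) [NeZero N] (W : WeierstrassCurve ℚ) (K : Type) [Field K] [NumberField K],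
      kolyvagin N W K)
    (hmod : hasEntireLFunction_rat) (hnf : exists_isNewformOf) (hMaz : mazur_not_dvd_maninConstant_of_odd)
    (W : WeierstrassCurve ℚ) [W.IsElliptic] [W.IsGloballyMinimal] [NeZero (W.conductorNorm ℤ)] (hX : ClassX11b W 3) (hns : ¬ Surj W 3)
    (hSL : CornerStepLAt W) (hTW : CornerTwistWitness.CornerTwistWitnessAt W) (hUp : CornerUpperAt W) :
    ∃ (K : Type) (_ : Field K) (_ : NumberField K)
      (Dt : ModularParametrizationData W (W.conductorNorm ℤ)) (H : HeegnerDatum (W.conductorNorm ℤ) (NumberField.discr K))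
      (ι : K →+* ℂ) (P : (W.baseChange K).toAffine.Point)
      (Wd : WeierstrassCurve ℚ) (_ : Wd.IsElliptic) (_ : Wd.IsGloballyMinimal) (Cd : VariableChange ℚ),
      IsImaginaryQuadratic K ∧ Odd (NumberField.discr K) ∧ SatisfiesHeegnerHypothesis (W.conductorNorm ℤ) K ∧
        (W.quadraticTwist (NumberField.discr K : ℚ)).entireLFunction 1 ≠ 0 ∧
        WeierstrassCurve.Affine.Point.map ι.toRatAlgHom P = heegnerPointComplex Dt H ∧ ¬ (3 : ℤ) ∣ Dt.c ∧
        Cd • W.quadraticTwist (NumberField.discr K : ℚ) = Wd ∧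
        IndexLowerBoundAt W 3 K P ∧ BSDp Wd 3 ∧
        (3 ∣ W.tamagawaProduct → Finite (W.baseChange K).sha → ¬ IsOfFinAddOrder P →
          padicValNat 3 (W.baseChange K).shaOrder + 2 * padicValNat 3 W.tamagawaProduct ≤
            2 * padicValNat 3 (AddSubgroup.zmultiples P).index) := by
  have hNS : integral_neronScaling_of_isGloballyMinimal :=
    integral_neronScaling_of_isGloballyMinimal_holds
  obtain ⟨hr, hp2, hmult, hirr⟩ := id hX
  obtain ⟨K, _, _, Wd, _, _, Cd, hK, hodd, -, hHN, -, hLt, hWd, hbsd⟩ := hTW hX hns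
  obtain ⟨Dt, H, ι, P, hP, hc⟩ :=
    exists_maninDatum_of_odd hnf hMaz hNS W 3 (W.conductorNorm ℤ) K rfl hp2 hmult hirr hK hHN
  refine ⟨K, inferInstance, inferInstance, Dt, H, ι, P, Wd, inferInstance, inferInstance, Cd, hK, hodd, hHN, hLt, hP, hc, hWd,
    ?_, hbsd, fun ht hfin hPinf ↦ hUp (W.conductorNorm ℤ) K Dt H ι P hX hns ht rfl hK hodd hHN hLt hP hc hPinf hfin⟩
  exact indexLowerBoundAt_of_cornerStepLAt hGZ hKo hmod poitouTate_sum_localTatePairing_eq_zero_holds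
    GaloisImage.EP.localEulerPoincareCharacteristic_adicCompletion W hX hns hSL (W.conductorNorm ℤ) K Dt H ι P rfl hK hodd hHN hLt hP hc

/-! ### §4 Closing the loop: the crux, through ONE frame, gives `BSD₃` on the corner -/

/-- **`Theses.ClassRecordThree.CornerAtThreeW` ⟹ `BSDp W 3` for every corner curve, THROUGH THE ONE-FRAME ∃ ONLY** (§3 then §2): a certified reading
that the route's use of crux 21420 factors through the one-frame shape. Print binders: GZ, Kolyvagin, GZK, modularity, newforms, Mazur's Manin constant,
Matar–Nekovář 2019 Thm. 0.3. CONDITIONAL; closes nothing; EVIDENCE only. [cite: JetchevSkinnerWan2017, §7.4.1–§7.4.2] [cite: MatarNekovar2019, Thm. 0.3]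
[cite: Mazur1978, Cor. 4.1] [cite: Miller2011LMS, Def. 1.1] -/
theorem bsdp_three_corner_of_cornerAtThreeW_via_oneFrame
    (hGZ : ∀ (N : ℕ) [NeZero N] (W : WeierstrassCurve ℚ) (K : Type) [Field K] [NumberField K],
      gross_zagier N W K)
    (hKo : ∀ (N : ℕ) [NeZero N] (W : WeierstrassCurve ℚ) (K : Type) [Field K] [NumberField K],
      kolyvagin N W K)
    (hGZK : rank_eq_analyticRank_of_analyticRank_le_one) (hmod : hasEntireLFunction_rat)
    (hnf : exists_isNewformOf) (hMaz : mazur_not_dvd_maninConstant_of_odd)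
    (hMN : ∀ (N : ℕ) [NeZero N] (W : WeierstrassCurve ℚ) (K : Type) [Field K] [NumberField K],
      MatarNekovar2019.thm03_padicValNat_card_sha_le_of_irreducible N W K)
    (h : Summit.BirchSwinnertonDyer.BirchSwinnertonDyer.Theses.ClassRecordThree.CornerAtThreeW)
    (W : WeierstrassCurve ℚ) [W.IsElliptic] [W.IsGloballyMinimal] (hX : ClassX11b W 3) (hns : ¬ Surj W 3) :
    BSDp W 3 := by
  haveI : Fact (Nat.Prime 3) := ⟨Nat.prime_three⟩
  haveI : NeZero (W.conductorNorm ℤ) := ⟨(W.conductorNorm_pos_holds).ne'⟩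
  obtain ⟨hSL, hTW, hUp⟩ := h W
  exact bsdp_three_corner_of_exists_oneFrame hGZ hKo hGZK hmod hMN W hX
    (exists_oneFrame_of_cornerConjuncts hGZ hKo hmod hnf hMaz W hX hns hSL hTW hUp)

end Summit.BirchSwinnertonDyer.BirchSwinnertonDyer.Theorems.CornerStrength

end
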